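import Summits.QuantumFields.YangMills.Theorems.UnitScaleTiltFluctuationComparisonRegPrIntLT8OfV7Leaves
import Summits.QuantumFields.YangMills.Theorems.UnitScaleTiltProp7ClosedFibreMinimiser
import Literature.MathematicalPhysics.QuantumFieldTheory.Balaban1983to89.T3SectASteps
import HarnessLib

/-!
# Route `UnitScaleTilt`, cruxes «MinimiserStabilityRegPr» (stmt-QuantumFields-19200, skeleton v9) and the DECIDING «FluctuationComparisonRegPrIntL»
# (stmt-QuantumFields-20520, skeleton v5kC, stub T8) — **ATTAINMENT OVER PRINT'S SPACE (6)(ε₀), AND v5kC's STUB T8, FROM [Balaban1985Variational]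
# PROP. 7's EXISTENCE CLAUSE ALONE (v9's `stub_existenceMinimalOrbit`) ∧ PROP. 8 (⇐ `stub_halvingStep`): the UNIQUENESS clause of Prop. 7 — hence
# v9's rows `stub_PV3A` ([Balaban1985RegularSpaces] Thm 2, XL) and `stub_PV3Cuniq` — is NOT CONSUMED on the way to T8, nor by v9's own composition**

Cell `ym3-torus` (HUMAN RULING D-0037, YM ladder rung R3), width seat `ym-ust-20520-w4` (g0).  THEOREMS ONLY (0 `def`, 0 `sorry`, standard axioms).

THE LOCATED FACT (kernel-certified here).  ★p2's `Variational.minSixAttainedAt_of_prop7_prop8` (p478378; consumed by v7/v8/v9's `variational_of_leaves_log` and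
by ★r1 g4's `InteriorExcision.thm1In8GlobalMin_of_v7Leaves`) takes V3 = `Prop7From14At` = clause (i) «at most one critical orbit in (6)(ε₀)» ∧ clause (ii)
«a minimal orbit in (6)(O₁L³B₃ε₁) from a background (14)», but its proof — §1 the global minimiser over the big fibre lies in (8) by Prop. 8 (it is R2-critical),
§2 Sect. A's background supply by induction on `k` ((11)–(14)), §3 the LOW/HIGH window split — reads clause (ii) ONLY (`(H7 …).2` at every call site).
This file re-derives the same chain with the hypothesis WEAKENED to clause (ii) in its member-uniform native closure = the registered text of v9's
`stub_existenceMinimalOrbit` (= route-R's stub E; OWNER RULING g24-№3′), and composes: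
* §1 `isMinOn_big_mem_small_of_existence`, §2 `background_of_existence` (induction on `k = K − n`, base `T3SectASteps.sat14_base`, step
  `mem_regFibrePr_height_succ`), §3 ★ `minSixAttainedAt_of_existence_prop8 : EX(L, B₃) → Prop8Printed B₃ (famX L) → ∃ â₀ â₁ > 0, MinSixAttainedAt L â₀ â₁ B₃`;
* §4 ★★ **`thm1In8GlobalMin_of_halvingStep_of_existence : ⟨v9 `stub_halvingStep` TEXT⟩ → ⟨v9 `stub_existenceMinimalOrbit` TEXT⟩ → ⟨v5kC `stub_thm1In8GlobalMin` TEXT⟩`**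
  (T8 VERBATIM; chain = ★r1 g4's with §3 in place of `minSixAttainedAt_of_prop7_prop8`), and `attained_in8_of_halvingStep_of_existence` = the exact variational inputs
  (`MinSixAttainedAt`, `MinimisersIn8At` for every `a₁`, `Prop8Printed`) that v9's `variational_of_leaves_log` draws from V3 ∧ V2 — now from H ∧ EX;
* §5 ★★ `thm1In8GlobalMin_of_halvingStep_of_interior`: T8 ⇐ `stub_halvingStep` ∧ the ONE interiority sentence of `UnitScaleTiltProp7ClosedFibreMinimiser` §4
  (route (β): direct method on the closed fibre; `existenceMinimalOrbit_of_interior_allL`).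
CONSEQUENCE OFFERED TO THE OWNER (no registry write here): 20520's T8 socket — and, since `MinimiserStabilityRegPr_of` consumes V3 only through
`minSixAttainedAt_of_prop7_prop8`, the 19200 composition itself — close from {`stub_halvingStep`, `stub_existenceMinimalOrbit`} (+ the landed V4′ and Sect. A∕D files);
rows A and C-uniq serve print's clause (i) only.

HONEST FRAMING.  By-name reductions; nothing of [Balaban1985Variational] is asserted or proved (H, EX, INTERIOR stay hypotheses); no stub, crux or count moves;
YM₃ on T³ is ladder rung R3 — not d = 4, not infinite volume, not a mass gap, not the Clay problem.

References: T. Bałaban, CMP **102** (1985) 277–309 [Balaban1985Variational] (Thm 1 (6)–(8) pp.278–279, Sect. A (11)–(14) pp.279–280, Prop. 7 p.299, Prop. 8 p.304).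
-/

set_option autoImplicit false

noncomputable section

namespace Summit.QuantumFields.YangMills.Theorems.AttainmentOfExistence

open scoped Matrix.Norms.L2Operator
open Literature.MathematicalPhysics.QuantumFieldTheory.Balaban1983to89
open Literature.MathematicalPhysics.QuantumFieldTheory.Balaban1983to89.T3ContinuumYM3Torus
open Literature.MathematicalPhysics.QuantumFieldTheory.Balaban1983to89.T3UnitLawDensityEML (ℰp)
open Literature.MathematicalPhysics.QuantumFieldTheory.Balaban1983to89.T3PrintedRegularMinimiser (RegPr regFibrePr mem_regFibrePr_iff)
open Literature.MathematicalPhysics.QuantumFieldTheory.Balaban1983to89.T3PrintedMinimiserExistence (Thm1GlobalMinAt regFibrePr_mono plaqSmall_of_le)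
open Literature.MathematicalPhysics.QuantumFieldTheory.Balaban1983to89.T3RegularMinimiser (regThreshold)
open Literature.MathematicalPhysics.QuantumFieldTheory.Balaban1983to89.T3ConstrainedMinimiser (fibre)
open Literature.MathematicalPhysics.QuantumFieldTheory.Balaban1983to89.T3TiltDescent (descendTo)
open Literature.MathematicalPhysics.QuantumFieldTheory.Balaban1983to89.T3LowerAlongMinimisersSplit (MinimisersIn8At)
open Literature.MathematicalPhysics.QuantumFieldTheory.Balaban1983to89.T3ExistSplit (MinSixAttainedAt)
open Literature.MathematicalPhysics.QuantumFieldTheory.Balaban1983to89.T3Thm1Carrier (famX Idx minimisersIn8At_of_prop8)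
open Literature.MathematicalPhysics.QuantumFieldTheory.Balaban1983to89.T3Thm1CarrierNative (IsCritR2 isCritR2_of_isMinOn Prop8NativeAt prop8Printed_famX_iff_native)
open Literature.MathematicalPhysics.QuantumFieldTheory.Balaban1983to89.T3SectASteps (secTo sat14_base plaqSmall_secTo mem_regFibrePr_height_succ)
open Literature.MathematicalPhysics.QuantumFieldTheory.Balaban1983to89.B10Eq27TorusAxialLog (toUField unitsField)
open Literature.MathematicalPhysics.QuantumFieldTheory.Balaban1983to89.B10Eq68TorusRegularity (covDivT)
open Literature.MathematicalPhysics.QuantumFieldTheory.Balaban1983to89.B11 (Prop8Printed)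
open Summit.QuantumFields.YangMills.Theorems.InteriorExcision (thm1In8_of_attained_of_in8)
open Summit.QuantumFields.YangMills.Theorems.Prop7ClosedFibreMinimiser (existenceMinimalOrbit_of_interior_allL)

/-! ## §1 From a background (14): a global minimiser over the big fibre lying in the small one — Prop. 7 (ii) ∧ Prop. 8 only -/

/-- **PROP. 7's EXISTENCE CLAUSE (global reading R1, member-uniform native form) ∧ PROP. 8 (native) FROM A BACKGROUND WITH (14)**: for a (7)-datum `V`
of height `n < K`, `0 < ε₁ ≤ a₁` (`a₁ ≤ a₁′`, `a₁ ≤ a₅/(O₁L³B₃)`, `O₁ ≥ 1`, `B₃ > 0`) and a background `U₀ ∈ 𝔘_k(L³B₃ε₁)` with `Ū₀ = V`, there is `U` in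
the SMALL fibre (8)(B₃ε₁) which minimises the Wilson action over the BIG fibre (6)(O₁L³B₃ε₁) — the minimiser of clause (ii) is critical in reading R2 and Prop. 8
applies since `O₁L³B₃ε₁ ≤ a₅`.  (= `Variational.isMinOn_big_mem_small_of_background_T3` with the uniqueness clause dropped from the hypothesis.)
[cite: Balaban1985Variational, Prop. 7 p.299, Prop. 8 p.304] -/
theorem isMinOn_big_mem_small_of_existence {L : ℕ} (hL : 1 < L) {B₃ a₁' O₁ a₅ a₁ : ℝ} (hB₃ : 0 < B₃) (hO₁ : 1 ≤ O₁)
    (h1 : a₁ ≤ a₁') (h3 : a₁ ≤ a₅ / (O₁ * (L : ℝ) ^ 3 * B₃))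
    (HEX : ∀ (F : T3Family), F.L = L → ∀ (n K : ℕ) (hnK : n < K) (ε₁ : ℝ), 0 < ε₁ →
      ∀ V : GaugeField (F.P n) 0 (Matrix.specialUnitaryGroup (Fin 2) ℂ), PlaqSmall ε₁ V →
        ∀ U₀ : GaugeField (F.P K) 0 (Matrix.specialUnitaryGroup (Fin 2) ℂ), RegPr F n K ((L : ℝ) ^ 3 * B₃ * ε₁) U₀ → U₀ ∈ fibre F ℰp n K hnK.le V →
          ε₁ ≤ a₁' → ∃ U ∈ regFibrePr F n K hnK.le (O₁ * (L : ℝ) ^ 3 * B₃ * ε₁) V,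
            IsMinOn (fun W : GaugeField (F.P K) 0 (Matrix.specialUnitaryGroup (Fin 2) ℂ) => wilsonAction4 W)
              (regFibrePr F n K hnK.le (O₁ * (L : ℝ) ^ 3 * B₃ * ε₁) V) U)
    (H8 : Prop8NativeAt L a₅ B₃)
    (F : T3Family) (hF : F.L = L) {n K : ℕ} (hnK : n < K) {ε₁ : ℝ} (hε₁ : 0 < ε₁) (hε₁a : ε₁ ≤ a₁)
    (V : GaugeField (F.P n) 0 (Matrix.specialUnitaryGroup (Fin 2) ℂ)) (hV : PlaqSmall ε₁ V)
    (U₀ : GaugeField (F.P K) 0 (Matrix.specialUnitaryGroup (Fin 2) ℂ)) (hU₀ : RegPr F n K ((L : ℝ) ^ 3 * B₃ * ε₁) U₀)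
    (hU₀B : U₀ ∈ fibre F ℰp n K hnK.le V) :
    ∃ U ∈ regFibrePr F n K hnK.le (B₃ * ε₁) V,
      IsMinOn (fun W : GaugeField (F.P K) 0 (Matrix.specialUnitaryGroup (Fin 2) ℂ) => wilsonAction4 W)
        (regFibrePr F n K hnK.le (O₁ * (L : ℝ) ^ 3 * B₃ * ε₁) V) U := by
  have hL1 : (1 : ℝ) ≤ L := by exact_mod_cast hL.le
  have hK : 0 < O₁ * (L : ℝ) ^ 3 * B₃ := by positivity
  have hbig : 0 < O₁ * (L : ℝ) ^ 3 * B₃ * ε₁ := mul_pos hK hε₁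
  -- Prop 8's window: `O₁L³B₃ε₁ ≤ a₅`
  have hε₀a₅ : O₁ * (L : ℝ) ^ 3 * B₃ * ε₁ ≤ a₅ := by
    have hKa : a₁ * (O₁ * (L : ℝ) ^ 3 * B₃) ≤ a₅ := (le_div_iff₀ hK).1 h3
    nlinarith [mul_le_mul_of_nonneg_left hε₁a hK.le]
  -- Prop 7, existence clause: a global minimiser over the big fibre
  obtain ⟨U, hUmem, hUmin⟩ := HEX F hF n K hnK ε₁ hε₁ V hV U₀ hU₀ hU₀B (hε₁a.trans h1)
  -- it is critical in reading R2, so Prop 8 puts it in (8)(B₃ε₁)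
  have hcrit : IsCritR2 F n K hnK.le V U := isCritR2_of_isMinOn hbig hUmem hUmin
  obtain ⟨hB, hIn⟩ := (mem_regFibrePr_iff F).mp hUmem
  have h8U : RegPr F n K (B₃ * ε₁) U := H8 F hF n K hnK _ ε₁ hε₁ hε₀a₅ V U hV hIn hB hcrit
  exact ⟨U, (mem_regFibrePr_iff F).mpr ⟨hB, h8U⟩, hUmin⟩

/-! ## §2 Sect. A's background supply from Prop. 7 (ii) ∧ Prop. 8 only -/

/-- **THE BACKGROUND SUPPLY OF SECT. A** for the d = 3 carriers (induction on `k = K − n`; (11)–(14) pp.279–280) from Prop. 7's EXISTENCE clause and Prop. 8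
ONLY: `B₃ > 4` for the `k = 1` background «U₀ = V₀» (`T3SectASteps.sat14_base`); for `k + 1` the (8)-member of §1 at height `n + 1` over `V₀ = secTo V`, lifted by
(12)–(13) (`mem_regFibrePr_height_succ`, `C₁ = L³`).  (= `Variational.background_T3'` with the uniqueness clause dropped.) [cite: Balaban1985Variational, Sect. A (11)-(14) pp.279-280] -/
theorem background_of_existence {L : ℕ} (hL : 1 < L) {B₃ a₁' O₁ a₅ a₁ : ℝ} (hB₃ : 4 < B₃) (hO₁ : 1 ≤ O₁)
    (h1 : a₁ ≤ a₁') (h3 : a₁ ≤ a₅ / (O₁ * (L : ℝ) ^ 3 * B₃))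
    (HEX : ∀ (F : T3Family), F.L = L → ∀ (n K : ℕ) (hnK : n < K) (ε₁ : ℝ), 0 < ε₁ →
      ∀ V : GaugeField (F.P n) 0 (Matrix.specialUnitaryGroup (Fin 2) ℂ), PlaqSmall ε₁ V →
        ∀ U₀ : GaugeField (F.P K) 0 (Matrix.specialUnitaryGroup (Fin 2) ℂ), RegPr F n K ((L : ℝ) ^ 3 * B₃ * ε₁) U₀ → U₀ ∈ fibre F ℰp n K hnK.le V →
          ε₁ ≤ a₁' → ∃ U ∈ regFibrePr F n K hnK.le (O₁ * (L : ℝ) ^ 3 * B₃ * ε₁) V,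
            IsMinOn (fun W : GaugeField (F.P K) 0 (Matrix.specialUnitaryGroup (Fin 2) ℂ) => wilsonAction4 W)
              (regFibrePr F n K hnK.le (O₁ * (L : ℝ) ^ 3 * B₃ * ε₁) V) U)
    (H8 : Prop8NativeAt L a₅ B₃) :
    ∀ (k : ℕ) (F : T3Family), F.L = L → ∀ (n K : ℕ) (hnK : n < K), K - n = k + 1 → ∀ ε₁ : ℝ, 0 < ε₁ → ε₁ ≤ a₁ →
      ∀ V : GaugeField (F.P n) 0 (Matrix.specialUnitaryGroup (Fin 2) ℂ), PlaqSmall ε₁ V →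
        ∃ U₀ : GaugeField (F.P K) 0 (Matrix.specialUnitaryGroup (Fin 2) ℂ),
          RegPr F n K ((L : ℝ) ^ 3 * B₃ * ε₁) U₀ ∧ U₀ ∈ fibre F ℰp n K hnK.le V := by
  have hB₃0 : 0 < B₃ := by linarith
  intro k
  induction k with
  | zero =>
    -- `k = 1`: «we take simply U₀ = V₀»
    intro F hF n K hnK hk ε₁ hε₁ _ V hV
    have hK : K = n + 1 := by omega
    subst hK
    have hFL : ((F.L : ℕ) : ℝ) = (L : ℝ) := by rw [hF]
    obtain ⟨hreg, hfib⟩ := sat14_base F n hB₃ hε₁ hV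
    rw [hFL] at hreg
    exact ⟨secTo F n (n + 1) (Nat.le_succ n) V, hreg, hfib⟩
  | succ k ih =>
    -- `k ↦ k + 1`: the (8)-member at height `n + 1` over `V₀ = secTo V`, lifted by (12)–(13)
    intro F hF n K hnK hk ε₁ hε₁ hε₁a V hV
    have hnK' : n + 1 < K := by omega
    have hFL : ((F.L : ℕ) : ℝ) = (L : ℝ) := by rw [hF]
    have hV₀reg : PlaqSmall ε₁ (secTo F n (n + 1) (Nat.le_succ n) V) := plaqSmall_secTo F (Nat.le_succ n) hε₁ hV
    obtain ⟨U₁, hU₁, hU₁B⟩ := ih F hF (n + 1) K hnK' (by omega) ε₁ hε₁ hε₁a _ hV₀reg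
    obtain ⟨U', hU'mem, -⟩ := isMinOn_big_mem_small_of_existence hL hB₃0 hO₁ h1 h3 HEX H8 F hF hnK' hε₁ hε₁a _ hV₀reg U₁ hU₁ hU₁B
    have h13 := mem_regFibrePr_height_succ F hnK'.le (mul_pos hB₃0 hε₁).le hU'mem
    obtain ⟨hfib, hreg⟩ := (mem_regFibrePr_iff F).mp h13
    refine ⟨U', ?_, hfib⟩
    rw [← hFL, mul_assoc]
    exact hreg

/-! ## §3 ★ Attainment over (6)(ε₀) from Prop. 7's existence clause and Prop. 8 -/

/-- ★ **ATTAINMENT OVER PRINT'S REGULAR FIBRE (6)(ε₀) FROM PROP. 7's EXISTENCE CLAUSE (member-uniform native form: v9's `stub_existenceMinimalOrbit` at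
`(L, B₃)`) AND PROP. 8 AT THE SAME `B₃ > 4`** — with `a₁ := min{a₁′, a₅/(O₁L³B₃)}`, `â₁ := a₁`, `â₀ := O₁L³B₃·a₁`: LOW window `ε₀ ≤ O₁L³B₃ε₁` at the global
minimiser over (6)(O₁L³B₃ε₁), which lies in (8)(B₃ε₁) ⊆ (6)(ε₀) by Prop. 8; HIGH window at `ε₁′ := ε₀/(O₁L³B₃) ≥ ε₁`; backgrounds from §2.
= `Variational.minSixAttainedAt_of_prop7_prop8` (p478378) with the UNIQUENESS CLAUSE OF PROP. 7 DROPPED from the hypothesis (its proof never read it).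
[cite: Balaban1985Variational, Prop. 7 p.299, Prop. 8 p.304, Thm 1 (8) p.279] -/
theorem minSixAttainedAt_of_existence_prop8 {L : ℕ} (hL : 1 < L) {B₃ : ℝ} (hB₃ : 4 < B₃)
    (HEX : ∃ a₁' O₁ : ℝ, 0 < a₁' ∧ 1 ≤ O₁ ∧ ∀ (F : T3Family), F.L = L → ∀ (n K : ℕ) (hnK : n < K) (ε₁ : ℝ), 0 < ε₁ →
      ∀ V : GaugeField (F.P n) 0 (Matrix.specialUnitaryGroup (Fin 2) ℂ), PlaqSmall ε₁ V →
        ∀ U₀ : GaugeField (F.P K) 0 (Matrix.specialUnitaryGroup (Fin 2) ℂ), RegPr F n K ((L : ℝ) ^ 3 * B₃ * ε₁) U₀ → U₀ ∈ fibre F ℰp n K hnK.le V →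
          ε₁ ≤ a₁' → ∃ U ∈ regFibrePr F n K hnK.le (O₁ * (L : ℝ) ^ 3 * B₃ * ε₁) V,
            IsMinOn (fun W : GaugeField (F.P K) 0 (Matrix.specialUnitaryGroup (Fin 2) ℂ) => wilsonAction4 W)
              (regFibrePr F n K hnK.le (O₁ * (L : ℝ) ^ 3 * B₃ * ε₁) V) U)
    (H8 : Prop8Printed B₃ (famX L)) :
    ∃ â₀ â₁ : ℝ, 0 < â₀ ∧ 0 < â₁ ∧ MinSixAttainedAt L â₀ â₁ B₃ := by
  obtain ⟨a₁', O₁, ha₁', hO₁, HEX⟩ := HEX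
  obtain ⟨a₅, ha₅, H8⟩ := prop8Printed_famX_iff_native.mp H8
  have hB₃0 : 0 < B₃ := by linarith
  have hL1 : (1 : ℝ) ≤ L := by exact_mod_cast hL.le
  have hK : 0 < O₁ * (L : ℝ) ^ 3 * B₃ := by positivity
  set a₁ : ℝ := min a₁' (a₅ / (O₁ * (L : ℝ) ^ 3 * B₃)) with ha₁_def
  have ha₁ : 0 < a₁ := lt_min ha₁' (div_pos ha₅ hK)
  have h1 : a₁ ≤ a₁' := min_le_left _ _
  have h3 : a₁ ≤ a₅ / (O₁ * (L : ℝ) ^ 3 * B₃) := min_le_right _ _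
  have hbg := background_of_existence hL hB₃ hO₁ h1 h3 HEX H8
  refine ⟨O₁ * (L : ℝ) ^ 3 * B₃ * a₁, a₁, mul_pos hK ha₁, ha₁, ?_⟩
  intro F hF n K hnK ε₁ ε₀ hε₁ hε₁a hlo hhi V hV
  by_cases hcase : ε₀ ≤ O₁ * (L : ℝ) ^ 3 * B₃ * ε₁
  · -- LOW window
    obtain ⟨U₀, hU₀, hU₀B⟩ := hbg (K - n - 1) F hF n K hnK (by omega) ε₁ hε₁ hε₁a V hV
    obtain ⟨U, hU8, hUmin⟩ := isMinOn_big_mem_small_of_existence hL hB₃0 hO₁ h1 h3 HEX H8 F hF hnK hε₁ hε₁a V hV U₀ hU₀ hU₀B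
    exact ⟨U, regFibrePr_mono F hlo V hU8, hUmin.on_subset (regFibrePr_mono F hcase V)⟩
  · -- HIGH window: the datum is (7)-small at `ε₁′ := ε₀/(O₁L³B₃) ∈ (ε₁, a₁]`
    rw [not_le] at hcase
    have hε₀ : 0 < ε₀ := (mul_pos hK hε₁).trans hcase
    set ε₁' : ℝ := ε₀ / (O₁ * (L : ℝ) ^ 3 * B₃) with hε₁'_def
    have hε₁' : 0 < ε₁' := div_pos hε₀ hK
    have hε₁le : ε₁ ≤ ε₁' := by
      rw [hε₁'_def, le_div_iff₀ hK]
      nlinarith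
    have hε₁'a : ε₁' ≤ a₁ := by
      rw [hε₁'_def, div_le_iff₀ hK]
      nlinarith
    have heq : O₁ * (L : ℝ) ^ 3 * B₃ * ε₁' = ε₀ := by
      rw [hε₁'_def]
      field_simp
    have hV' : PlaqSmall ε₁' V := plaqSmall_of_le hε₁le hV
    obtain ⟨U₀, hU₀, hU₀B⟩ := hbg (K - n - 1) F hF n K hnK (by omega) ε₁' hε₁' hε₁'a V hV'
    obtain ⟨U, hUmem, hUmin⟩ := HEX F hF n K hnK ε₁' hε₁' V hV' U₀ hU₀ hU₀B (hε₁'a.trans h1)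
    rw [heq] at hUmem hUmin
    exact ⟨U, hUmem, hUmin⟩

/-! ## §4 ★★ v5kC's stub T8 — and v9's variational inputs — from `stub_halvingStep` ∧ `stub_existenceMinimalOrbit` -/

/-- ★★ **STUB T8 OF v5kC FROM TWO OF v9's FOUR STUBS, BY NAME.**  Hypotheses = the registered texts of `stub_halvingStep` (V2′: the Sect. F halving step of
[Balaban1985Variational] Prop. 8, one `B₃ > 4` per block size) and `stub_existenceMinimalOrbit` (Prop. 7's EXISTENCE clause from a background (14), reading R1, for
every `B₃ > 4`) VERBATIM; conclusion = the text of `stub_thm1In8GlobalMin` VERBATIM.  Chain: V2′ ⟹ Prop. 8 (`Prop8Iter.prop8_of_halvingLiteral`) ⟹ attainment over (6)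
(§3) and «minimisers lie in (8)» (`T3Thm1Carrier.minimisersIn8At_of_prop8`) ⟹ T8 at the common window (`InteriorExcision.thm1In8_of_attained_of_in8`).  The rows
`stub_PV3A`, `stub_PV3Cuniq` of v9 do not enter.  `Odd L` is not used. [cite: Balaban1985Variational, Thm 1 (8) p.279, Prop. 7 p.299, Prop. 8 p.304] -/
theorem thm1In8GlobalMin_of_halvingStep_of_existence
    (hV2 : ∀ (L : ℕ), 1 < L → ∃ B₃ : ℝ, 4 < B₃ ∧ ∃ a₅ : ℝ, 0 < a₅ ∧
      ∀ (i : Idx L) (ε₀ ε₁ : ℝ), 0 < ε₁ → ∀ (V : (famX L i).Bdry) (U : (famX L i).Cfg), (famX L i).Reg7 ε₁ V → (famX L i).InU ε₀ U →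
        (famX L i).InB V U → (famX L i).IsCritical V U → ε₀ ≤ a₅ → (famX L i).InU (max (B₃ * ε₁) (ε₀ / 2)) U)
    (hEX : ∀ (L : ℕ), 1 < L → ∀ (B₃ : ℝ), 4 < B₃ → ∃ a₁' O₁ : ℝ, 0 < a₁' ∧ 1 ≤ O₁ ∧
      ∀ (F : T3Family), F.L = L → ∀ (n K : ℕ) (hnK : n < K) (ε₁ : ℝ), 0 < ε₁ →
        ∀ V : GaugeField (F.P n) 0 (Matrix.specialUnitaryGroup (Fin 2) ℂ), PlaqSmall ε₁ V →
          ∀ U₀ : GaugeField (F.P K) 0 (Matrix.specialUnitaryGroup (Fin 2) ℂ), RegPr F n K ((L : ℝ) ^ 3 * B₃ * ε₁) U₀ → U₀ ∈ fibre F ℰp n K hnK.le V →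
            ε₁ ≤ a₁' → ∃ U ∈ regFibrePr F n K hnK.le (O₁ * (L : ℝ) ^ 3 * B₃ * ε₁) V,
              IsMinOn (fun W : GaugeField (F.P K) 0 (Matrix.specialUnitaryGroup (Fin 2) ℂ) => wilsonAction4 W)
                (regFibrePr F n K hnK.le (O₁ * (L : ℝ) ^ 3 * B₃ * ε₁) V) U) :
    ∀ L : ℕ, Odd L → 1 < L → ∃ a₀ a₁ B₃ : ℝ, 0 < a₀ ∧ 0 < a₁ ∧ 0 < B₃ ∧
      Thm1GlobalMinAt L a₀ a₁ B₃ ∧ MinimisersIn8At L a₀ a₁ B₃ := by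
  intro L _ hL
  obtain ⟨B₃, hB₃, h8⟩ := Summit.QuantumFields.YangMills.Theorems.Prop8Iter.prop8_of_halvingLiteral hV2 L hL
  have hB₃0 : 0 < B₃ := by linarith
  obtain ⟨â₀, â₁, hâ₀, hâ₁, hatt⟩ := minSixAttainedAt_of_existence_prop8 hL hB₃ (hEX L hL B₃ hB₃) h8
  obtain ⟨a₅, ha₅, h8'⟩ := minimisersIn8At_of_prop8 hB₃0 h8
  exact thm1In8_of_attained_of_in8 hâ₀ hâ₁ ha₅ hâ₁ hB₃0 hatt (h8' â₁)

/-- **THE VARIATIONAL INPUTS OF v9's `variational_of_leaves_log` FROM H ∧ EX**: for every `L > 1`, one `B₃ > 4` with Prop. 8 at the carriers (`Prop8Printed`, from the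
halving literal), attainment over (6) on a window (`MinSixAttainedAt`, §3) and «minimisers lie in (8)» for every `a₁` (`MinimisersIn8At`) — exactly what that composition
draws from V3 ∧ V2 (its third input, the log-Lipschitz schema V4′, is a landed theorem and reads `B₃` only).  So a v9 composition fed by `stub_halvingStep` and
`stub_existenceMinimalOrbit` alone type-checks along the same lines. [cite: Balaban1985Variational, Thm 1 p.279, Prop. 7 p.299, Prop. 8 p.304] -/
theorem attained_in8_of_halvingStep_of_existence
    (hV2 : ∀ (L : ℕ), 1 < L → ∃ B₃ : ℝ, 4 < B₃ ∧ ∃ a₅ : ℝ, 0 < a₅ ∧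
      ∀ (i : Idx L) (ε₀ ε₁ : ℝ), 0 < ε₁ → ∀ (V : (famX L i).Bdry) (U : (famX L i).Cfg), (famX L i).Reg7 ε₁ V → (famX L i).InU ε₀ U →
        (famX L i).InB V U → (famX L i).IsCritical V U → ε₀ ≤ a₅ → (famX L i).InU (max (B₃ * ε₁) (ε₀ / 2)) U)
    (hEX : ∀ (L : ℕ), 1 < L → ∀ (B₃ : ℝ), 4 < B₃ → ∃ a₁' O₁ : ℝ, 0 < a₁' ∧ 1 ≤ O₁ ∧
      ∀ (F : T3Family), F.L = L → ∀ (n K : ℕ) (hnK : n < K) (ε₁ : ℝ), 0 < ε₁ →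
        ∀ V : GaugeField (F.P n) 0 (Matrix.specialUnitaryGroup (Fin 2) ℂ), PlaqSmall ε₁ V →
          ∀ U₀ : GaugeField (F.P K) 0 (Matrix.specialUnitaryGroup (Fin 2) ℂ), RegPr F n K ((L : ℝ) ^ 3 * B₃ * ε₁) U₀ → U₀ ∈ fibre F ℰp n K hnK.le V →
            ε₁ ≤ a₁' → ∃ U ∈ regFibrePr F n K hnK.le (O₁ * (L : ℝ) ^ 3 * B₃ * ε₁) V,
              IsMinOn (fun W : GaugeField (F.P K) 0 (Matrix.specialUnitaryGroup (Fin 2) ℂ) => wilsonAction4 W)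
                (regFibrePr F n K hnK.le (O₁ * (L : ℝ) ^ 3 * B₃ * ε₁) V) U) :
    ∀ L : ℕ, 1 < L → ∃ â₀ â₁ a₅ B₃ : ℝ, 0 < â₀ ∧ 0 < â₁ ∧ 0 < a₅ ∧ 4 < B₃ ∧
      Prop8Printed B₃ (famX L) ∧ MinSixAttainedAt L â₀ â₁ B₃ ∧ ∀ a₁ : ℝ, MinimisersIn8At L a₅ a₁ B₃ := by
  intro L hL
  obtain ⟨B₃, hB₃, h8⟩ := Summit.QuantumFields.YangMills.Theorems.Prop8Iter.prop8_of_halvingLiteral hV2 L hL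
  have hB₃0 : 0 < B₃ := by linarith
  obtain ⟨â₀, â₁, hâ₀, hâ₁, hatt⟩ := minSixAttainedAt_of_existence_prop8 hL hB₃ (hEX L hL B₃ hB₃) h8
  obtain ⟨a₅, ha₅, h8'⟩ := minimisersIn8At_of_prop8 hB₃0 h8
  exact ⟨â₀, â₁, a₅, B₃, hâ₀, hâ₁, ha₅, hB₃, h8, hatt, h8'⟩

/-! ## §5 ★★ T8 by route (β): `stub_halvingStep` ∧ the interiority sentence of the closed-fibre direct method -/

/-- ★★ **v5kC's STUB T8 ⇐ `stub_halvingStep` ∧ «CLOSED-FIBRE MINIMISERS ARE INTERIOR»** (route (β) of OWNER RULING g24-№3′: the direct method on print's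
closed regular fibre, `UnitScaleTiltProp7ClosedFibreMinimiser.existenceMinimalOrbit_of_interior_allL`, supplies `stub_existenceMinimalOrbit` from the ONE
displayed ∀-sentence; then §4).  Both remaining hypotheses are a-priori estimates of Sect. F's species on minimisers; no chart, no [Balaban1985RegularSpaces] Thm 2,
no Props 5–6 enter. [cite: Balaban1985Variational, Thm 1 (8) p.279, Prop. 7 p.299, Prop. 8 p.304] -/
theorem thm1In8GlobalMin_of_halvingStep_of_interior
    (hV2 : ∀ (L : ℕ), 1 < L → ∃ B₃ : ℝ, 4 < B₃ ∧ ∃ a₅ : ℝ, 0 < a₅ ∧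
      ∀ (i : Idx L) (ε₀ ε₁ : ℝ), 0 < ε₁ → ∀ (V : (famX L i).Bdry) (U : (famX L i).Cfg), (famX L i).Reg7 ε₁ V → (famX L i).InU ε₀ U →
        (famX L i).InB V U → (famX L i).IsCritical V U → ε₀ ≤ a₅ → (famX L i).InU (max (B₃ * ε₁) (ε₀ / 2)) U)
    (hInt : ∀ L : ℕ, 1 < L → ∀ B₃ : ℝ, 4 < B₃ → ∃ a₁' O₁ : ℝ, 0 < a₁' ∧ 1 ≤ O₁ ∧
      ∀ F : T3Family, F.L = L → ∀ (n K : ℕ) (hnK : n < K) (ε₁ : ℝ), 0 < ε₁ → ε₁ ≤ a₁' →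
        ∀ V : GaugeField (F.P n) 0 (Matrix.specialUnitaryGroup (Fin 2) ℂ), PlaqSmall ε₁ V →
          ∀ U₀ : GaugeField (F.P K) 0 (Matrix.specialUnitaryGroup (Fin 2) ℂ), RegPr F n K ((L : ℝ) ^ 3 * B₃ * ε₁) U₀ →
            U₀ ∈ fibre F ℰp n K hnK.le V →
            ∀ Ū : GaugeField (F.P K) 0 (Matrix.specialUnitaryGroup (Fin 2) ℂ),
              Ū ∈ {U : GaugeField (F.P K) 0 (Matrix.specialUnitaryGroup (Fin 2) ℂ) | ∀ p : Plaq (F.P K) 0,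
                    GaugeGroup.dist1 (GaugeField.plaqHol U p) ≤ regThreshold F n K (O₁ * (L : ℝ) ^ 3 * B₃ * ε₁)} ∩
                  descendTo F ℰp n K hnK.le ⁻¹' {V} ∩
                  {U | ∀ b : PBond (F.P K) 0, ‖covDivT 1 (unitsField (toUField U)) b.dir b.src‖ ≤
                    (O₁ * (L : ℝ) ^ 3 * B₃ * ε₁) * ((F.L : ℝ)⁻¹) ^ (3 * (K - n))} →
              IsMinOn (fun W : GaugeField (F.P K) 0 (Matrix.specialUnitaryGroup (Fin 2) ℂ) => wilsonAction4 W)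
                ({U : GaugeField (F.P K) 0 (Matrix.specialUnitaryGroup (Fin 2) ℂ) | ∀ p : Plaq (F.P K) 0,
                    GaugeGroup.dist1 (GaugeField.plaqHol U p) ≤ regThreshold F n K (O₁ * (L : ℝ) ^ 3 * B₃ * ε₁)} ∩
                  descendTo F ℰp n K hnK.le ⁻¹' {V} ∩
                  {U | ∀ b : PBond (F.P K) 0, ‖covDivT 1 (unitsField (toUField U)) b.dir b.src‖ ≤
                    (O₁ * (L : ℝ) ^ 3 * B₃ * ε₁) * ((F.L : ℝ)⁻¹) ^ (3 * (K - n))}) Ū →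
              RegPr F n K (O₁ * (L : ℝ) ^ 3 * B₃ * ε₁) Ū) :
    ∀ L : ℕ, Odd L → 1 < L → ∃ a₀ a₁ B₃ : ℝ, 0 < a₀ ∧ 0 < a₁ ∧ 0 < B₃ ∧
      Thm1GlobalMinAt L a₀ a₁ B₃ ∧ MinimisersIn8At L a₀ a₁ B₃ :=
  thm1In8GlobalMin_of_halvingStep_of_existence hV2 (existenceMinimalOrbit_of_interior_allL hInt)

end Summit.QuantumFields.YangMills.Theorems.AttainmentOfExistence

end
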